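import Literature.NumberTheory.EllipticCurves.DeuringSplitOrdinaryCertProofs
import Literature.NumberTheory.EllipticCurves.DeuringSplitOrdinarySqrtTwoProofs
import Literature.NumberTheory.EllipticCurves.CMIsogenyCertificates
import Literature.NumberTheory.EllipticCurves.CMIsogenyCertificate163
import Literature.NumberTheory.EllipticCurves.ComplexMultiplicationHasCMThirteenProofs
import Literature.NumberTheory.EllipticCurves.ComplexMultiplicationDeuringReduction
import Literature.NumberTheory.EllipticCurves.VariableChangePoints
import Literature.NumberTheory.EllipticCurves.VariableChangePointsMap
import Mathlib.AlgebraicGeometry.EllipticCurve.IsomOfJ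
import Mathlib.Data.Fintype.Parity
import HarnessLib

/-!
# Deuring's theorem, split case: the nine maximal-order CM `j`-invariants, model by model

Topic `NumberTheory/EllipticCurves` (trunk T-ELLARITH, notion `cm_endomorphisms_isogeny`).
This file turns the model-level results

* `DeuringCert.exists_ne_zero_nsmul_eq_zero_of_isogenyCert` (`DeuringSplitOrdinaryCertProofs`:
  a kernel-certified CM isogeny `E → E^{(d)}` gives `[√d]`, and `E mod p` has a point of order
  `p` at a split prime `p`), applied to the six certificates `cert7, …, cert163` of
  `CMIsogenyCertificates` and to two tiny new ones (`cert3`: the `3`-isogeny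
  `y² = x³ + 1 → y² = x³ - 27`, giving `[√-3]`; `cert4`: the identity `E → E^{(-1)} = E` on
  `y² = x³ + x`, giving `[i]`, `i² = -1`), and
* `DeuringSqrtTwo.exists_ne_zero_nsmul_eq_zero` (`DeuringSplitOrdinarySqrtTwoProofs`, `j = 8000`),

into the statement for **an arbitrary globally minimal `W/ℚ` with the given `j`-invariant and its
reduction `reductionModPrime W p`** (`exists_pTorsion_of_j_*`), through:

1. `j` is constant: `j(reductionModPrime W p) = j(W) mod p` for an integral `j(W)`
   (`c₄³ = j Δ` over `ℤ` from `map_integralModelInt`, with `j = c₄³/Δ`,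
   `WeierstrassCurve.j_eq_c₄_pow_three_div_Δ` of `ComplexMultiplicationHasCMThirteenProofs`), and
   likewise for the models;
2. over `\overline{𝔽_p}` two elliptic curves with the same `j` are isomorphic (Mathlib's
   `WeierstrassCurve.exists_variableChange_of_j_eq`), and an isomorphism transports points of
   order `p` (`VariableChange.pointEquiv`, `Affine.Point.congrEquiv`);
3. the one prime of good reduction for some `W` but bad for the model, `(d, p) = (-11, 3)`
   (a short integral model of `j = -2¹⁵` is never good at `3`), is settled by the curve
   `y² = x³ + x² + 2x + 1` over `𝔽₃` (`j = 1 = -2¹⁵ mod 3`) and its rational point `(0, 1)` of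
   order `3`.

Lang, *Elliptic Functions*, Ch. 13 §4 Thm. 12 (first assertion, split case); Deuring (1941).

## References

* [Lang1987] S. Lang, *Elliptic Functions*, 2nd ed., Ch. 13 §4 Thm. 12 (PDF pp. 140–141).
* [Deuring1941] M. Deuring, *Die Typen der Multiplikatorenringe elliptischer Funktionenkörper*.
* [SilvermanAEC2009] *AEC*, III.1.4(b) (`j` classifies over `K̄`), App. A Prop. 1.2(b);
  [SilvermanAdvancedTopics1994] *AT*, App. A §3 (the models).

## Design

Theorems, plus the two tiny certificates (`def`s with integer literals, checked by `decide`).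
-/

noncomputable section

open scoped Classical

open Polynomial WeierstrassCurve Literature.NumberTheory.EllipticCurves.PolyCert
  Literature.NumberTheory.EllipticCurves.CMIsogenyCert

universe u

namespace Literature.NumberTheory.EllipticCurves

namespace DeuringModels

/-! ## Transport of points of order `n` -/

/-- Points of order dividing `n` transport along injective homomorphisms. [folklore] -/
theorem exists_ne_zero_nsmul_eq_zero_of_injective {G H : Type*} [AddCommGroup G] [AddCommGroup H]
    (f : G →+ H) (hf : Function.Injective f) {n : ℕ} (h : ∃ P : G, P ≠ 0 ∧ n • P = 0) :
    ∃ Q : H, Q ≠ 0 ∧ n • Q = 0 := by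
  obtain ⟨P, hP0, hPn⟩ := h
  refine ⟨f P, fun h0 ↦ hP0 (hf (by rw [h0, map_zero])), ?_⟩
  rw [← map_nsmul, hPn, map_zero]

/-- **Two elliptic curves over `𝔽_p` with the same `j`-invariant have the "same" `n`-torsion over
`\overline{𝔽_p}`**: they become isomorphic over the algebraic closure (Silverman, *AEC*,
III.1.4(b); Mathlib's `exists_variableChange_of_j_eq`), and the isomorphism of groups of
`\overline{𝔽_p}`-points (`VariableChange.pointEquiv`) transports points of order `n`.
[cite: SilvermanAEC2009, Prop. III.1.4(b)] -/
theorem exists_ne_zero_nsmul_eq_zero_of_j_eq {p : ℕ} [Fact p.Prime]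
    (V V' : WeierstrassCurve (ZMod p)) [V.IsElliptic] [V'.IsElliptic] (hj : V.j = V'.j) {n : ℕ}
    (h : ∃ P : V.geomPoints, P ≠ 0 ∧ n • P = 0) :
    ∃ P : V'.geomPoints, P ≠ 0 ∧ n • P = 0 := by
  have hjE : (V.baseChange (AlgebraicClosure (ZMod p))).j = (V'.baseChange (AlgebraicClosure (ZMod p))).j := by
    rw [j_eq_c₄_pow_three_div_Δ, j_eq_c₄_pow_three_div_Δ]
    simp only [WeierstrassCurve.baseChange, map_c₄, map_Δ]
    rw [← map_pow, ← map_pow, ← map_div₀, ← map_div₀, ← j_eq_c₄_pow_three_div_Δ,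
      ← j_eq_c₄_pow_three_div_Δ, hj]
  obtain ⟨C, hC⟩ := WeierstrassCurve.exists_variableChange_of_j_eq _ _ hjE
  exact exists_ne_zero_nsmul_eq_zero_of_injective
    ((Affine.Point.congrEquiv hC).toAddMonoidHom.comp
      (VariableChange.pointEquiv (V.baseChange (AlgebraicClosure (ZMod p))) C).toAddMonoidHom)
    ((Affine.Point.congrEquiv hC).injective.comp (VariableChange.pointEquiv _ C).injective) h

/-! ## `j` of integral models modulo `p` -/

/-- **`j` modulo `p` of an integral model**: if `c₄³ = n Δ` over `ℤ` and `p ∤ Δ`, then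
`j(M mod p) = n`. [folklore] -/
theorem j_map_intCast {p : ℕ} [Fact p.Prime] (M : WeierstrassCurve ℤ) (n : ℤ)
    (h : M.c₄ ^ 3 = n * M.Δ) [hE : (M.map (Int.castRingHom (ZMod p))).IsElliptic] :
    (M.map (Int.castRingHom (ZMod p))).j = n := by
  have hΔ : (M.map (Int.castRingHom (ZMod p))).Δ ≠ 0 := by
    rw [← WeierstrassCurve.coe_Δ']; exact (M.map (Int.castRingHom (ZMod p))).Δ'.ne_zero
  rw [j_eq_c₄_pow_three_div_Δ, div_eq_iff hΔ, map_c₄, map_Δ, eq_intCast, eq_intCast, ← Int.cast_pow, h,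
    Int.cast_mul]

/-- **`c₄³ = j Δ` for the integral model** of a globally minimal `W/ℚ` with integral
`j`-invariant `j(W) = n`. [folklore] -/
theorem c₄_pow_three_integralModelInt (W : WeierstrassCurve ℚ) [W.IsElliptic] [W.IsGloballyMinimal]
    (n : ℤ) (hj : W.j = n) :
    (integralModelInt W).c₄ ^ 3 = n * (integralModelInt W).Δ := by
  have hc : W.c₄ = ((integralModelInt W).c₄ : ℚ) := by
    conv_lhs => rw [← map_integralModelInt W]
    rw [map_c₄, eq_intCast]
  have hΔ : W.Δ = ((integralModelInt W).Δ : ℚ) := by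
    conv_lhs => rw [← map_integralModelInt W]
    rw [map_Δ, eq_intCast]
  have hΔ0 : W.Δ ≠ 0 := by rw [← WeierstrassCurve.coe_Δ']; exact W.Δ'.ne_zero
  have h := j_eq_c₄_pow_three_div_Δ W
  rw [hj, eq_div_iff hΔ0, hc, hΔ] at h
  exact_mod_cast h.symm

/-- `j(reductionModPrime W p) = j(W) mod p` for integral `j(W) = n` and `p ∤ Δ_W`. [folklore] -/
theorem j_reductionModPrime (W : WeierstrassCurve ℚ) [W.IsElliptic] [W.IsGloballyMinimal]
    (n : ℤ) (hj : W.j = n) {p : ℕ} [Fact p.Prime] (hΔ : ¬ (p : ℤ) ∣ minimalDiscriminantInt W) :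
    haveI := isElliptic_reductionModPrime W hΔ
    (reductionModPrime W p).j = n :=
  haveI := isElliptic_reductionModPrime W hΔ
  j_map_intCast (integralModelInt W) n (c₄_pow_three_integralModelInt W n hj)

/-- **From a model to every curve with the same `j`.** If some elliptic `V/𝔽_p` with `j(V) = n`
has a point of order `p` over `\overline{𝔽_p}`, then so does the reduction of every globally
minimal `W/ℚ` with `j(W) = n` and good reduction at `p`. [folklore] -/
theorem exists_pTorsion_reductionModPrime_of_model (W : WeierstrassCurve ℚ) [W.IsElliptic]
    [W.IsGloballyMinimal] (n : ℤ) (hj : W.j = n) {p : ℕ} [Fact p.Prime]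
    (hΔ : ¬ (p : ℤ) ∣ minimalDiscriminantInt W) (V : WeierstrassCurve (ZMod p)) [V.IsElliptic]
    (hV : V.j = n) (h : ∃ P : V.geomPoints, P ≠ 0 ∧ p • P = 0) :
    ∃ P : (reductionModPrime W p).geomPoints, P ≠ 0 ∧ p • P = 0 := by
  haveI := isElliptic_reductionModPrime W hΔ
  exact exists_ne_zero_nsmul_eq_zero_of_j_eq V (reductionModPrime W p)
    (by rw [hV, j_reductionModPrime W n hj hΔ]) h

/-! ## Arithmetic helpers -/

/-- A prime dividing `q ^ k` for a prime `q` equals `q`. [folklore] -/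
theorem eq_of_prime_dvd_prime_pow {p q : ℕ} (hp : p.Prime) (hq : q.Prime) {k : ℕ}
    (h : (p : ℤ) ∣ (q : ℤ) ^ k) : p = q := by
  have hpZ := Nat.prime_iff_prime_int.mp hp
  have h1 : (p : ℤ) ∣ (q : ℤ) := hpZ.dvd_of_dvd_pow h
  rw [Int.natCast_dvd_natCast] at h1
  exact (Nat.prime_dvd_prime_iff_eq hp hq).mp h1

/-- A prime dividing a product divides a factor. [folklore] -/
theorem prime_dvd_mul {p : ℕ} (hp : p.Prime) {a b : ℤ} (h : (p : ℤ) ∣ a * b) :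
    (p : ℤ) ∣ a ∨ (p : ℤ) ∣ b :=
  (Nat.prime_iff_prime_int.mp hp).dvd_or_dvd h

/-- `IsSquare (m² d) → IsSquare d` in `𝔽_p` for `p ∤ m`. [folklore] -/
theorem isSquare_of_isSquare_mul_sq {p : ℕ} [Fact p.Prime] {d : ZMod p} {m : ZMod p} (hm : m ≠ 0)
    (h : IsSquare (m ^ 2 * d)) : IsSquare d := by
  obtain ⟨r, hr⟩ := h
  refine ⟨r / m, ?_⟩
  field_simp
  rw [mul_comm, hr]; ring

/-! ## The two tiny certificates: `[√-3]` on `y² = x³ + 1` and `[i]` on `y² = x³ + x` -/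

/-- Certificate of the `3`-isogeny `E : y² = x³ + 1 → E' = E/E[√-3] = E^{(-3)} : y² = x³ - 27`,
`(x, y) ↦ ((x³ + 4)/x², y(x³ - 8)/x³)` with kernel `{O, (0, ±1)} = E[√-3]` (Vélu's formulae for a
`3`-torsion point; the case `m = 0`, `s = 1` of the tree's `ThreeIsogeny`). [folklore] -/
def cert3 : IsogenyCert where
  a₁ := 0
  a₂ := 0
  a₃ := 0
  a₄ := 0
  a₆ := 1
  a₁' := 0
  a₂' := 0
  a₃' := 0
  a₄' := 0
  a₆' := -27
  U := [4, 0, 0, 1]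
  h := [0, 1]
  S := [-8, 0, 0, 1]
  T := []

/-- Bézout certificate modulo `10007` for `cert3` (`¼(x³ + 4) - ¼x²·x = 1`). [folklore] -/
def cert3Cop : CoprimeCert where
  ℓ := 10007
  a := [2502]
  b := [0, 0, -2502]
  q := [1]

/-- `cert3` passes the isogeny-formula check. [cite: SilvermanAEC2009, Thm. III.4.8] -/
theorem check_cert3 : cert3.check = true := by decide

/-- `cert3` passes the coprimality check. [folklore] -/
theorem checkCoprime_cert3 : cert3.checkCoprime cert3Cop 20 = true := by decide

/-- Certificate of the identity `E : y² = x³ + x → E^{(-1)} = E` (`U = x`, `h = 1`), whose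
twist by `i = √-1` is the automorphism `[i] : (x, y) ↦ (-x, iy)`. [cite: SilvermanAdvancedTopics1994, II Prop. 2.3.1(i)] -/
def cert4 : IsogenyCert where
  a₁ := 0
  a₂ := 0
  a₃ := 0
  a₄ := 1
  a₆ := 0
  a₁' := 0
  a₂' := 0
  a₃' := 0
  a₄' := 1
  a₆' := 0
  U := [0, 1]
  h := [1]
  S := [1]
  T := []

/-- Bézout certificate for `cert4` (`0·x + 1·1 = 1`). [folklore] -/
def cert4Cop : CoprimeCert where
  ℓ := 10007
  a := []
  b := [1]
  q := []

/-- `cert4` passes the isogeny-formula check. [cite: SilvermanAEC2009, Thm. III.4.8] -/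
theorem check_cert4 : cert4.check = true := by decide

/-- `cert4` passes the coprimality check. [folklore] -/
theorem checkCoprime_cert4 : cert4.checkCoprime cert4Cop 20 = true := by decide

/-- `10007` is prime. [folklore] -/
theorem prime_10007 : Nat.Prime 10007 := by norm_num

/-! ## The numeric side conditions of the eight certificates -/

/-- `cert3` is a CM twist certificate for `d = -3`. [folklore] -/
theorem isCMTwistCert_cert3 : DeuringCert.IsCMTwistCert cert3 (-3) where
  a₁ := rfl
  a₂ := rfl
  a₃ := rfl
  a₁' := rfl
  a₂' := rfl
  a₃' := rfl
  a₄' := by decide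
  a₆' := by decide
  T := rfl
  U_top := by decide
  h_top := by decide
  deg := by decide

/-- `cert4` is a CM twist certificate for `d = -1`. [folklore] -/
theorem isCMTwistCert_cert4 : DeuringCert.IsCMTwistCert cert4 (-1) where
  a₁ := rfl
  a₂ := rfl
  a₃ := rfl
  a₁' := rfl
  a₂' := rfl
  a₃' := rfl
  a₄' := by decide
  a₆' := by decide
  T := rfl
  U_top := by decide
  h_top := by decide
  deg := by decide

/-- `cert7` is a CM twist certificate for `d = -7`. [folklore] -/
theorem isCMTwistCert_cert7 : DeuringCert.IsCMTwistCert cert7 (-7) where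
  a₁ := rfl
  a₂ := rfl
  a₃ := rfl
  a₁' := rfl
  a₂' := rfl
  a₃' := rfl
  a₄' := by decide
  a₆' := by decide
  T := rfl
  U_top := by decide
  h_top := by decide
  deg := by decide

/-- `cert11` is a CM twist certificate for `d = -11`. [folklore] -/
theorem isCMTwistCert_cert11 : DeuringCert.IsCMTwistCert cert11 (-11) where
  a₁ := rfl
  a₂ := rfl
  a₃ := rfl
  a₁' := rfl
  a₂' := rfl
  a₃' := rfl
  a₄' := by decide
  a₆' := by decide
  T := rfl
  U_top := by decide
  h_top := by decide
  deg := by decide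

/-- `cert19` is a CM twist certificate for `d = -19`. [folklore] -/
theorem isCMTwistCert_cert19 : DeuringCert.IsCMTwistCert cert19 (-19) where
  a₁ := rfl
  a₂ := rfl
  a₃ := rfl
  a₁' := rfl
  a₂' := rfl
  a₃' := rfl
  a₄' := by decide
  a₆' := by decide
  T := rfl
  U_top := by decide
  h_top := by decide
  deg := by decide

/-- `cert43` is a CM twist certificate for `d = -43`. [folklore] -/
theorem isCMTwistCert_cert43 : DeuringCert.IsCMTwistCert cert43 (-43) where
  a₁ := rfl
  a₂ := rfl
  a₃ := rfl
  a₁' := rfl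
  a₂' := rfl
  a₃' := rfl
  a₄' := by decide
  a₆' := by decide
  T := rfl
  U_top := by decide
  h_top := by decide
  deg := by decide

/-- `cert67` is a CM twist certificate for `d = -67`. [folklore] -/
theorem isCMTwistCert_cert67 : DeuringCert.IsCMTwistCert cert67 (-67) where
  a₁ := rfl
  a₂ := rfl
  a₃ := rfl
  a₁' := rfl
  a₂' := rfl
  a₃' := rfl
  a₄' := by decide
  a₆' := by decide
  T := rfl
  U_top := by decide
  h_top := by decide
  deg := by decide

/-- `cert163` is a CM twist certificate for `d = -163`. [folklore] -/
theorem isCMTwistCert_cert163 : DeuringCert.IsCMTwistCert cert163 (-163) where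
  a₁ := rfl
  a₂ := rfl
  a₃ := rfl
  a₁' := rfl
  a₂' := rfl
  a₃' := rfl
  a₄' := by decide
  a₆' := by decide
  T := rfl
  U_top := by decide +kernel
  h_top := by decide +kernel
  deg := by decide +kernel

/-! ## Discriminants and `j`-invariants of the models -/

/-- `Δ` and `c₄³ = jΔ` for `y² = x³ + 1` (`j = 0`). [folklore] -/
theorem model3 : (DeuringCert.curve cert3).Δ = -(2 ^ 4 * 3 ^ 3) ∧
    (DeuringCert.curve cert3).c₄ ^ 3 = 0 * (DeuringCert.curve cert3).Δ := by
  constructor <;> decide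

/-- `Δ` and `c₄³ = jΔ` for `y² = x³ + x` (`j = 1728`). [folklore] -/
theorem model4 : (DeuringCert.curve cert4).Δ = -(2 ^ 6) ∧
    (DeuringCert.curve cert4).c₄ ^ 3 = 1728 * (DeuringCert.curve cert4).Δ := by
  constructor <;> decide

/-- `Δ` and `c₄³ = jΔ` for the model of `cert7` (`j = -3375`). [folklore] -/
theorem model7 : (DeuringCert.curve cert7).Δ = -(2 ^ 12 * 3 ^ 12 * 7 ^ 3) ∧
    (DeuringCert.curve cert7).c₄ ^ 3 = -3375 * (DeuringCert.curve cert7).Δ := by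
  constructor <;> decide

/-- `Δ` and `c₄³ = jΔ` for the model of `cert11` (`j = -32768`). [folklore] -/
theorem model11 : (DeuringCert.curve cert11).Δ = -(2 ^ 12 * 3 ^ 12 * 11 ^ 3) ∧
    (DeuringCert.curve cert11).c₄ ^ 3 = -32768 * (DeuringCert.curve cert11).Δ := by
  constructor <;> decide

/-- `Δ` and `c₄³ = jΔ` for the model of `cert19` (`j = -884736`). [folklore] -/
theorem model19 : (DeuringCert.curve cert19).Δ = -(2 ^ 12 * 19 ^ 3) ∧
    (DeuringCert.curve cert19).c₄ ^ 3 = -884736 * (DeuringCert.curve cert19).Δ := by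
  constructor <;> decide

/-- `Δ` and `c₄³ = jΔ` for the model of `cert43` (`j = -884736000`). [folklore] -/
theorem model43 : (DeuringCert.curve cert43).Δ = -(2 ^ 12 * 43 ^ 3) ∧
    (DeuringCert.curve cert43).c₄ ^ 3 = -884736000 * (DeuringCert.curve cert43).Δ := by
  constructor <;> decide

/-- `Δ` and `c₄³ = jΔ` for the model of `cert67` (`j = -147197952000`). [folklore] -/
theorem model67 : (DeuringCert.curve cert67).Δ = -(2 ^ 12 * 67 ^ 3) ∧
    (DeuringCert.curve cert67).c₄ ^ 3 = -147197952000 * (DeuringCert.curve cert67).Δ := by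
  constructor <;> decide

/-- `Δ` and `c₄³ = jΔ` for the model of `cert163` (`j = -262537412640768000`). [folklore] -/
theorem model163 : (DeuringCert.curve cert163).Δ = -(2 ^ 12 * 163 ^ 3) ∧
    (DeuringCert.curve cert163).c₄ ^ 3 = -262537412640768000 * (DeuringCert.curve cert163).Δ := by
  constructor <;> decide

/-! ## The generic certificate theorem, specialised -/

section Cert

variable {c : IsogenyCert} {d : ℤ} [Fact (d < 0)] {p : ℕ} [Fact p.Prime]

/-- **From a certificate to every curve with the model's `j`-invariant.** [folklore] -/
theorem exists_pTorsion_of_cert (hc : c.check = true) (H : DeuringCert.IsCMTwistCert c d)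
    (cop : CoprimeCert) {k' : ℕ} (hcop : c.checkCoprime cop k' = true) (hℓ : cop.ℓ.Prime)
    (hp2 : p ≠ 2) (hpd : ¬ (p : ℤ) ∣ d) (hsq : IsSquare ((d : ℤ) : ZMod p))
    (hΔc : ¬ (p : ℤ) ∣ (DeuringCert.curve c).Δ) (n : ℤ)
    (hn : (DeuringCert.curve c).c₄ ^ 3 = n * (DeuringCert.curve c).Δ)
    (W : WeierstrassCurve ℚ) [W.IsElliptic] [W.IsGloballyMinimal] (hj : W.j = n)
    (hΔ : ¬ (p : ℤ) ∣ minimalDiscriminantInt W) :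
    ∃ P : (reductionModPrime W p).geomPoints, P ≠ 0 ∧ p • P = 0 := by
  haveI : ((DeuringCert.curve c).map (Int.castRingHom (ZMod p))).IsElliptic := by
    rw [isElliptic_iff, map_Δ, isUnit_iff_ne_zero, eq_intCast, Ne, ZMod.intCast_zmod_eq_zero_iff_dvd]
    exact hΔc
  exact exists_pTorsion_reductionModPrime_of_model W n hj hΔ _ (j_map_intCast _ n hn)
    (DeuringCert.exists_ne_zero_nsmul_eq_zero_of_isogenyCert hc H cop hcop hℓ hp2 hpd hsq hΔc)

end Cert

/-! ## The special fibre `(d, p) = (-11, 3)` -/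

section Three

/-- `V₃ : y² = x³ + x² + 2x + 1` over `𝔽₃` (`Δ = 1`, `j = 1`, `#V₃(𝔽₃) = 3`). [folklore] -/
def V₃ : WeierstrassCurve (ZMod 3) := ⟨0, 1, 0, 2, 1⟩

/-- `Δ(V₃) = 1`. [folklore] -/
theorem V₃_Δ : V₃.Δ = 1 := by decide

/-- `c₄(V₃) = 1`. [folklore] -/
theorem V₃_c₄ : V₃.c₄ = 1 := by decide

/-- `V₃` is an elliptic curve. [folklore] -/
instance isElliptic_V₃ : V₃.IsElliptic := ⟨by rw [V₃_Δ]; exact isUnit_one⟩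

/-- `j(V₃) = 1`. [folklore] -/
theorem V₃_j : V₃.j = 1 := by
  rw [j_eq_c₄_pow_three_div_Δ, V₃_Δ, V₃_c₄]; norm_num

/-- `(0, 1) ∈ V₃(𝔽₃)`. [folklore] -/
theorem V₃_nonsingular : V₃.toAffine.Nonsingular 0 1 :=
  (Affine.equation_iff_nonsingular_of_Δ_ne_zero (by rw [V₃_Δ]; exact one_ne_zero)).mp
    (by rw [Affine.equation_iff]; decide)

/-- The coefficients of `V₃`. [folklore] -/
theorem V₃_a : V₃.a₁ = 0 ∧ V₃.a₂ = 1 ∧ V₃.a₃ = 0 ∧ V₃.a₄ = 2 := ⟨rfl, rfl, rfl, rfl⟩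

/-- **`V₃` has a point of order `3` over `\overline{𝔽₃}`**: `Q = (0, 1)` satisfies `Q + Q = -Q`
(tangent slope `1`, `x(2Q) = 0`, `y(2Q) = -1`), computed over `\overline{𝔽₃}`. [folklore] -/
theorem exists_three_torsion_V₃ : ∃ P : V₃.geomPoints, P ≠ 0 ∧ 3 • P = 0 := by
  obtain ⟨hA₁, hA₂, hA₃, hA₄⟩ := V₃_a
  have hns : (V₃.baseChange (AlgebraicClosure (ZMod 3))).toAffine.Nonsingular 0 1 := by
    have := (Affine.map_nonsingular (W := V₃) (algebraMap (ZMod 3) (AlgebraicClosure (ZMod 3))).injective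
      0 1).mpr V₃_nonsingular
    rw [map_zero, map_one] at this
    exact this
  have ha₁ : (V₃.baseChange (AlgebraicClosure (ZMod 3))).a₁ = 0 := by simp [hA₁, WeierstrassCurve.baseChange]
  have ha₂ : (V₃.baseChange (AlgebraicClosure (ZMod 3))).a₂ = 1 := by simp [hA₂, WeierstrassCurve.baseChange]
  have ha₄ : (V₃.baseChange (AlgebraicClosure (ZMod 3))).a₄ = 2 := by
    simp [hA₄, WeierstrassCurve.baseChange, map_ofNat]
  have h2 : (2 : AlgebraicClosure (ZMod 3)) ≠ 0 := by
    intro h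
    have h' : ((2 : ℕ) : AlgebraicClosure (ZMod 3)) = 0 := by exact_mod_cast h
    rw [CharP.cast_eq_zero_iff (AlgebraicClosure (ZMod 3)) 3] at h'
    omega
  have hnegY : (V₃.baseChange (AlgebraicClosure (ZMod 3))).toAffine.negY 0 1 = -1 := by
    simp [Affine.negY, hA₁, hA₃]
  have hy : (1 : AlgebraicClosure (ZMod 3)) ≠ (V₃.baseChange (AlgebraicClosure (ZMod 3))).toAffine.negY 0 1 := by
    rw [hnegY]; intro h
    apply h2
    linear_combination h
  have hslope : (V₃.baseChange (AlgebraicClosure (ZMod 3))).toAffine.slope 0 0 1 1 = 1 := by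
    rw [Affine.slope_of_Y_ne rfl hy, hnegY]
    simp only [ha₁, ha₂, ha₄, toAffine_a₁, toAffine_a₂, toAffine_a₄]
    norm_num
    exact h2
  have hQQ : (Affine.Point.some 0 1 hns : (V₃.baseChange (AlgebraicClosure (ZMod 3))).toAffine.Point) +
      .some 0 1 hns = -(.some 0 1 hns) := by
    rw [Affine.Point.neg_some, Affine.Point.add_self_of_Y_ne hy]
    obtain ⟨h', e'⟩ := some_eq_some_of_eq (Affine.nonsingular_add hns hns fun h ↦ hy h.2)
      (x' := 0) (y' := (V₃.baseChange (AlgebraicClosure (ZMod 3))).toAffine.negY 0 1)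
      (by rw [hslope]; simp [Affine.addX, hA₁, hA₂])
      (by rw [hslope]; simp [Affine.addY, Affine.negAddY, Affine.addX, Affine.negY, hA₁, hA₂, hA₃])
    exact e'
  refine ⟨.some 0 1 hns, Affine.Point.some_ne_zero _, ?_⟩
  rw [succ_nsmul, two_nsmul]
  change ((Affine.Point.some 0 1 hns : (V₃.baseChange (AlgebraicClosure (ZMod 3))).toAffine.Point) +
      .some 0 1 hns) + .some 0 1 hns = 0
  rw [hQQ, neg_add_cancel]

/-- **`j = -2¹⁵` at `p = 3`.** The reduction modulo `3` of a globally minimal `W/ℚ` with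
`j(W) = -32768` and good reduction at `3` has a point of order `3` over `\overline{𝔽₃}`
(`j ≡ 1 (mod 3)`, compare with `V₃`). [folklore] -/
theorem exists_pTorsion_reductionModPrime_three (W : WeierstrassCurve ℚ) [W.IsElliptic]
    [W.IsGloballyMinimal] (hj : W.j = (-32768 : ℤ)) (hΔ : ¬ ((3 : ℕ) : ℤ) ∣ minimalDiscriminantInt W) :
    ∃ P : (reductionModPrime W 3).geomPoints, P ≠ 0 ∧ 3 • P = 0 :=
  exists_pTorsion_reductionModPrime_of_model W (-32768) hj hΔ V₃ (by rw [V₃_j]; decide)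
    exists_three_torsion_V₃

end Three

/-! ## The nine `j`-invariants -/

section Nine

variable (W : WeierstrassCurve ℚ) [W.IsElliptic] [W.IsGloballyMinimal] {p : ℕ} [Fact p.Prime]
  (hp2 : p ≠ 2) (hΔ : ¬ (p : ℤ) ∣ minimalDiscriminantInt W)

/-- `-7` is not a square modulo `3`. [folklore] -/
theorem not_isSquare_neg_seven_mod_three : ¬ IsSquare ((-7 : ℤ) : ZMod 3) := by decide

include hp2 hΔ in
/-- **`j = 0` (`d = -3`).** [cite: Lang1987, Ch. 13 §4 Thm. 12] -/
theorem exists_pTorsion_of_j_zero (hj : W.j = 0) (hpd : ¬ (p : ℤ) ∣ -3)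
    (hsq : IsSquare ((-3 : ℤ) : ZMod p)) :
    ∃ P : (reductionModPrime W p).geomPoints, P ≠ 0 ∧ p • P = 0 := by
  haveI : Fact ((-3 : ℤ) < 0) := ⟨by norm_num⟩
  have hp := (Fact.out : p.Prime)
  refine exists_pTorsion_of_cert check_cert3 isCMTwistCert_cert3 cert3Cop checkCoprime_cert3
    prime_10007 hp2 hpd hsq ?_ 0 model3.2 W (by rw [hj]; simp) hΔ
  rw [model3.1, Int.dvd_neg]
  intro h
  rcases prime_dvd_mul hp h with h | h
  · exact hp2 (eq_of_prime_dvd_prime_pow hp Nat.prime_two h)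
  · exact hpd (by rw [eq_of_prime_dvd_prime_pow hp Nat.prime_three h]; norm_num)

include hp2 hΔ in
/-- **`j = 1728` (`d = -4`).** [cite: Lang1987, Ch. 13 §4 Thm. 12] -/
theorem exists_pTorsion_of_j_1728 (hj : W.j = 1728) (hsq : IsSquare ((-4 : ℤ) : ZMod p)) :
    ∃ P : (reductionModPrime W p).geomPoints, P ≠ 0 ∧ p • P = 0 := by
  haveI : Fact ((-1 : ℤ) < 0) := ⟨by norm_num⟩
  have hp := (Fact.out : p.Prime)
  have hsq' : IsSquare ((-1 : ℤ) : ZMod p) := by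
    refine isSquare_of_isSquare_mul_sq (m := 2) (DeuringSqrtTwo.two_ne_zero_zmod hp2) ?_
    convert hsq using 1; push_cast; ring
  refine exists_pTorsion_of_cert check_cert4 isCMTwistCert_cert4 cert4Cop checkCoprime_cert4
    prime_10007 hp2 (by rw [Int.dvd_neg]; exact_mod_cast hp.one_lt.ne' ∘ Nat.dvd_one.mp) hsq' ?_
    1728 model4.2 W (by rw [hj]; norm_num) hΔ
  rw [model4.1, Int.dvd_neg]
  exact fun h ↦ hp2 (eq_of_prime_dvd_prime_pow hp Nat.prime_two h)

include hp2 hΔ in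
/-- **`j = -3375` (`d = -7`).** [cite: Lang1987, Ch. 13 §4 Thm. 12] -/
theorem exists_pTorsion_of_j_neg3375 (hj : W.j = -3375) (hpd : ¬ (p : ℤ) ∣ -7)
    (hsq : IsSquare ((-7 : ℤ) : ZMod p)) :
    ∃ P : (reductionModPrime W p).geomPoints, P ≠ 0 ∧ p • P = 0 := by
  haveI : Fact ((-7 : ℤ) < 0) := ⟨by norm_num⟩
  have hp := (Fact.out : p.Prime)
  have hp3 : p ≠ 3 := by
    rintro rfl
    exact not_isSquare_neg_seven_mod_three hsq
  refine exists_pTorsion_of_cert (IsogenyCert.check_of_checkFast checkFast_cert7) isCMTwistCert_cert7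
    cert7Cop checkCoprime_cert7 prime_10007 hp2 hpd hsq ?_ (-3375) model7.2 W (by rw [hj]; norm_num) hΔ
  rw [model7.1, Int.dvd_neg]
  intro h
  rcases prime_dvd_mul hp h with h | h
  · rcases prime_dvd_mul hp h with h | h
    · exact hp2 (eq_of_prime_dvd_prime_pow hp Nat.prime_two h)
    · exact hp3 (eq_of_prime_dvd_prime_pow hp Nat.prime_three h)
  · exact hpd (by rw [eq_of_prime_dvd_prime_pow hp (by norm_num) h]; norm_num)

include hp2 hΔ in
/-- **`j = 8000` (`d = -8`).** [cite: Lang1987, Ch. 13 §4 Thm. 12] -/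
theorem exists_pTorsion_of_j_8000 (hj : W.j = 8000) (hsq : IsSquare ((-8 : ℤ) : ZMod p)) :
    ∃ P : (reductionModPrime W p).geomPoints, P ≠ 0 ∧ p • P = 0 := by
  have h2 := DeuringSqrtTwo.two_ne_zero_zmod (p := p) hp2
  have hsq' : IsSquare ((-2 : ℤ) : ZMod p) := by
    refine isSquare_of_isSquare_mul_sq (m := 2) h2 ?_
    convert hsq using 1; push_cast; ring
  obtain ⟨r, hr⟩ := hsq'
  have hs : r ^ 2 = -2 := by rw [pow_two, ← hr]; push_cast; ring
  haveI := DeuringSqrtTwo.isElliptic_curve (p := p) hp2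
  exact exists_pTorsion_reductionModPrime_of_model W 8000 (by rw [hj]; norm_num) hΔ
    (DeuringSqrtTwo.curve p) (by rw [DeuringSqrtTwo.j_curve hp2]; norm_num)
    (DeuringSqrtTwo.exists_ne_zero_nsmul_eq_zero hp2 r hs)

include hp2 hΔ in
/-- **`j = -32768` (`d = -11`)**, with the special fibre `p = 3`. [cite: Lang1987, Ch. 13 §4 Thm. 12] -/
theorem exists_pTorsion_of_j_neg32768 (hj : W.j = -32768) (hpd : ¬ (p : ℤ) ∣ -11)
    (hsq : IsSquare ((-11 : ℤ) : ZMod p)) :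
    ∃ P : (reductionModPrime W p).geomPoints, P ≠ 0 ∧ p • P = 0 := by
  haveI : Fact ((-11 : ℤ) < 0) := ⟨by norm_num⟩
  have hp := (Fact.out : p.Prime)
  by_cases hp3 : p = 3
  · subst hp3
    exact exists_pTorsion_reductionModPrime_three W (by rw [hj]; norm_num) hΔ
  refine exists_pTorsion_of_cert (IsogenyCert.check_of_checkFast checkFast_cert11) isCMTwistCert_cert11
    cert11Cop checkCoprime_cert11 prime_10007 hp2 hpd hsq ?_ (-32768) model11.2 W (by rw [hj]; norm_num) hΔ
  rw [model11.1, Int.dvd_neg]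
  intro h
  rcases prime_dvd_mul hp h with h | h
  · rcases prime_dvd_mul hp h with h | h
    · exact hp2 (eq_of_prime_dvd_prime_pow hp Nat.prime_two h)
    · exact hp3 (eq_of_prime_dvd_prime_pow hp Nat.prime_three h)
  · exact hpd (by rw [eq_of_prime_dvd_prime_pow hp (by norm_num) h]; norm_num)

include hp2 hΔ in
/-- **The four `j`-invariants `-884736, -884736000, -147197952000, -262537412640768000`
(`d = -19, -43, -67, -163`)** share one proof shape; here `d = -19`. [cite: Lang1987, Ch. 13 §4 Thm. 12] -/
theorem exists_pTorsion_of_j_neg884736 (hj : W.j = -884736) (hpd : ¬ (p : ℤ) ∣ -19)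
    (hsq : IsSquare ((-19 : ℤ) : ZMod p)) :
    ∃ P : (reductionModPrime W p).geomPoints, P ≠ 0 ∧ p • P = 0 := by
  haveI : Fact ((-19 : ℤ) < 0) := ⟨by norm_num⟩
  have hp := (Fact.out : p.Prime)
  refine exists_pTorsion_of_cert (IsogenyCert.check_of_checkFast checkFast_cert19) isCMTwistCert_cert19
    cert19Cop checkCoprime_cert19 prime_10007 hp2 hpd hsq ?_ (-884736) model19.2 W (by rw [hj]; norm_num) hΔ
  rw [model19.1, Int.dvd_neg]
  intro h
  rcases prime_dvd_mul hp h with h | h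
  · exact hp2 (eq_of_prime_dvd_prime_pow hp Nat.prime_two h)
  · exact hpd (by rw [eq_of_prime_dvd_prime_pow hp (by norm_num) h]; norm_num)

include hp2 hΔ in
/-- **`j = -884736000` (`d = -43`).** [cite: Lang1987, Ch. 13 §4 Thm. 12] -/
theorem exists_pTorsion_of_j_neg884736000 (hj : W.j = -884736000) (hpd : ¬ (p : ℤ) ∣ -43)
    (hsq : IsSquare ((-43 : ℤ) : ZMod p)) :
    ∃ P : (reductionModPrime W p).geomPoints, P ≠ 0 ∧ p • P = 0 := by
  haveI : Fact ((-43 : ℤ) < 0) := ⟨by norm_num⟩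
  have hp := (Fact.out : p.Prime)
  refine exists_pTorsion_of_cert (IsogenyCert.check_of_checkFast checkFast_cert43) isCMTwistCert_cert43
    cert43Cop checkCoprime_cert43 prime_10007 hp2 hpd hsq ?_ (-884736000) model43.2 W
    (by rw [hj]; norm_num) hΔ
  rw [model43.1, Int.dvd_neg]
  intro h
  rcases prime_dvd_mul hp h with h | h
  · exact hp2 (eq_of_prime_dvd_prime_pow hp Nat.prime_two h)
  · exact hpd (by rw [eq_of_prime_dvd_prime_pow hp (by norm_num) h]; norm_num)

include hp2 hΔ in
/-- **`j = -147197952000` (`d = -67`).** [cite: Lang1987, Ch. 13 §4 Thm. 12] -/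
theorem exists_pTorsion_of_j_neg147197952000 (hj : W.j = -147197952000) (hpd : ¬ (p : ℤ) ∣ -67)
    (hsq : IsSquare ((-67 : ℤ) : ZMod p)) :
    ∃ P : (reductionModPrime W p).geomPoints, P ≠ 0 ∧ p • P = 0 := by
  haveI : Fact ((-67 : ℤ) < 0) := ⟨by norm_num⟩
  have hp := (Fact.out : p.Prime)
  refine exists_pTorsion_of_cert (IsogenyCert.check_of_checkFast checkFast_cert67) isCMTwistCert_cert67
    cert67Cop checkCoprime_cert67 prime_10007 hp2 hpd hsq ?_ (-147197952000) model67.2 W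
    (by rw [hj]; norm_num) hΔ
  rw [model67.1, Int.dvd_neg]
  intro h
  rcases prime_dvd_mul hp h with h | h
  · exact hp2 (eq_of_prime_dvd_prime_pow hp Nat.prime_two h)
  · exact hpd (by rw [eq_of_prime_dvd_prime_pow hp (by norm_num) h]; norm_num)

include hp2 hΔ in
/-- **`j = -262537412640768000` (`d = -163`).** [cite: Lang1987, Ch. 13 §4 Thm. 12] -/
theorem exists_pTorsion_of_j_neg262537412640768000 (hj : W.j = -262537412640768000)
    (hpd : ¬ (p : ℤ) ∣ -163) (hsq : IsSquare ((-163 : ℤ) : ZMod p)) :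
    ∃ P : (reductionModPrime W p).geomPoints, P ≠ 0 ∧ p • P = 0 := by
  haveI : Fact ((-163 : ℤ) < 0) := ⟨by norm_num⟩
  have hp := (Fact.out : p.Prime)
  refine exists_pTorsion_of_cert (IsogenyCert.check_of_checkFast checkFast_cert163) isCMTwistCert_cert163
    cert163Cop checkCoprime_cert163 prime_10007 hp2 hpd hsq ?_ (-262537412640768000) model163.2 W
    (by rw [hj]; norm_num) hΔ
  rw [model163.1, Int.dvd_neg]
  intro h
  rcases prime_dvd_mul hp h with h | h
  · exact hp2 (eq_of_prime_dvd_prime_pow hp Nat.prime_two h)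
  · exact hpd (by rw [eq_of_prime_dvd_prime_pow hp (by norm_num) h]; norm_num)

end Nine

end DeuringModels

end Literature.NumberTheory.EllipticCurves
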